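import Summits.QuantumFields.QCD.Theorems.SpectralDefectExtinctionWegnerEstimateSketchDefs

/-!
# Crux `WegnerEstimate` (item stmt-QuantumFields-8966), line `Sketch` gen 2c: locality of the port min-functional

`badPort R w` reads the link datum `w` ONLY at the links based in the cube `box 4 R` (the cell links of the resolvent
cell): every other link enters `latticeApply` multiplied by a zero-extended field value outside the cube.  Consequences:
in `stub_currentRigidity`/`stub_portSmallBall` the exterior `U` of the glued configuration is immaterial, and the Haar
small-ball estimate is a statement about the cell links alone.  Written by the line lead
(prover-line-stmt-QuantumFields-8966-c2-0).
-/

noncomputable section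

namespace Summit.QuantumFields.QCD.Cruxes.WegnerEstimate.ResolventCell

open scoped BigOperators
open Literature.MathematicalPhysics.QuantumLattice Literature.MathematicalPhysics.QuantumFieldTheory
  Literature.Probability.LatticeModels

/-- Sites of the port domain lie in the cube. -/
theorem mem_box_of_mem_portDomain {R : ℕ} {y : Fin 4 → ℤ} (h : y ∈ portDomain R) : y ∈ box 4 R :=
  (Finset.mem_filter.mp h).1

/-- The zero extension vanishes off the cube. -/
theorem portVal_eq_zero_of_not_mem_box {R : ℕ} (φ : PortField R) {y : Fin 4 → ℤ} (hy : y ∉ box 4 R) (a : Fin 3)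
    (α : Fin 4) : portVal φ y a α = 0 := by
  simp only [portVal]
  rw [dif_neg]
  exact fun h => hy (mem_box_of_mem_portDomain h)

/-- `latticeApply` on a port field at a site of the cube depends on the link datum only through the cube's links. -/
theorem latticeApply_congr_cube {R : ℕ} (m₀ : ℝ) {w w' : LinkData}
    (hw : ∀ y ∈ box 4 R, ∀ μ : Fin 4, w (y, μ) = w' (y, μ)) (φ : PortField R) {y : Fin 4 → ℤ} (hy : y ∈ box 4 R)
    (a : Fin 3) (α : Fin 4) :
    latticeApply m₀ w (portVal φ) y a α = latticeApply m₀ w' (portVal φ) y a α := by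
  simp only [latticeApply]
  congr 1
  refine Finset.sum_congr rfl fun μ _ => Finset.sum_congr rfl fun b _ => Finset.sum_congr rfl fun β _ => ?_
  rw [hw y hy μ]
  by_cases h : y - Pi.single μ 1 ∈ box 4 R
  · rw [hw _ h μ]
  · rw [portVal_eq_zero_of_not_mem_box φ h]
    simp

/-- `latticeCurrent` of a port field through a cube link depends only on that link. -/
theorem latticeCurrent_congr_cube {R : ℕ} {w w' : LinkData}
    (hw : ∀ y ∈ box 4 R, ∀ μ : Fin 4, w (y, μ) = w' (y, μ)) (φ : PortField R) {y : Fin 4 → ℤ} (hy : y ∈ box 4 R)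
    (μ : Fin 4) (i : Fin 8) :
    latticeCurrent w (portVal φ) y μ i = latticeCurrent w' (portVal φ) y μ i := by
  simp only [latticeCurrent, hw y hy μ]

/-- **Locality of the port min-functional**: `badPort R` depends on the link datum only through the links based in
the cube `box 4 R`. -/
theorem badPort_congr_cube (R : ℕ) {w w' : LinkData} (hw : ∀ y ∈ box 4 R, ∀ μ : Fin 4, w (y, μ) = w' (y, μ)) :
    badPort R w = badPort R w' := by
  have hI : ∀ (m₀ lam : ℝ) (φ : PortField R),
      portInteriorResSq R m₀ lam w φ = portInteriorResSq R m₀ lam w' φ := by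
    intro m₀ lam φ
    refine Finset.sum_congr rfl fun y hy => Finset.sum_congr rfl fun a _ => Finset.sum_congr rfl fun α _ => ?_
    rw [latticeApply_congr_cube m₀ hw φ (box_mono 4 (Nat.sub_le R 1) hy)]
  have hF : ∀ (m₀ lam : ℝ) (φ : PortField R), portFaceResSq R m₀ lam w φ = portFaceResSq R m₀ lam w' φ := by
    intro m₀ lam φ
    refine Finset.sum_congr rfl fun y hy => Finset.sum_congr rfl fun a _ => Finset.sum_congr rfl fun α _ => ?_
    have hy' : y ∈ box 4 R := (Finset.mem_filter.mp hy).1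
    congr 2
    exact Finset.sum_congr rfl fun β _ => by rw [latticeApply_congr_cube m₀ hw φ hy']
  have hC : ∀ φ : PortField R, portCurrentSum R w φ = portCurrentSum R w' φ := by
    intro φ
    refine Finset.sum_congr rfl fun y hy => Finset.sum_congr rfl fun μ _ => Finset.sum_congr rfl fun i _ => ?_
    rw [latticeCurrent_congr_cube hw φ hy]
  simp only [badPort, hI, hF, hC]

/-- **The exterior is immaterial**: read around `x`, two glued configurations with the same cell links give the same
value of `badPort R` — in particular `badPort R` of `glue_{x,R}(U, V)` does not depend on `U`. -/
theorem badPort_glue_indep {R : ℕ} {L : ℕ} [NeZero L] (x : TorusSite 4 L) (U U' V : GaugeConfig 4 L SU3) :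
    badPort R (fun l => (fun e : Edge 4 L => if (∃ y ∈ box 4 R, e.1 = x + Torus.proj L y) then V e else U e)
        (x + Torus.proj L l.1, l.2)) =
      badPort R (fun l => (fun e : Edge 4 L => if (∃ y ∈ box 4 R, e.1 = x + Torus.proj L y) then V e else U' e)
        (x + Torus.proj L l.1, l.2)) := by
  refine badPort_congr_cube R fun y hy μ => ?_
  have h : ∃ y' ∈ box 4 R, x + Torus.proj L y = x + Torus.proj L y' := ⟨y, hy, rfl⟩
  simp only [if_pos h]

end Summit.QuantumFields.QCD.Cruxes.WegnerEstimate.ResolventCell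

end
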